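import Literature.Algebra.Homology.CoinducedConjugation
import Literature.Algebra.Homology.PermutationDualCoinduced
import HarnessLib

/-!
# The right-action model `Maps(G/S, A) ≅ Coind_S^G(A|_S)` and its translation operators

Topic `Algebra/Homology`; namespace `Literature.Algebra.Homology` (sub-namespace `QuotientMaps`).
Definitions + theorems (no named fact, no `sorry`, no instance).

For a group `G`, a subgroup `S ≤ G` and `A : Rep k G`, the `G`-module of functions
`φ : G ⧸ S → A` with the diagonal action `(g ⋆ φ)(y) = g · φ(g⁻¹ y)` — the tree's
`PermutationDual.funRepr A (G ⧸ S)` (`PermutationDualCoinduced`) — is isomorphic in `Rep k G` to the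
coinduced module `coindSub S A = Coind_S^G(A|_S)` of `CoinducedConjugation`
(`{f : G → A | f(sg) = s f(g)}`, `(g f)(x) = f(xg)`):
**`funRepIsoCoindSub`**, `φ ↦ (g ↦ g · φ(g⁻¹S))`, inverse `f ↦ (gS ↦ g · f(g⁻¹))`.
For `S` normal the right translations **`rTrans S A c`**, `(R_c φ)(y) = φ(y c)` (`c ∈ G/S`), are
`G`-endomorphisms with `R_{cd} = R_c ∘ R_d` (the conventions of
`ContinuousShapiroOpenCoinducedRightAction.coindOpenRTrans`, discrete case), and the isomorphism carries
`R_{tS}` to the conjugation operator `D_t` of `CoinducedConjugation`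
(`(D_t f)(g) = t · f(t⁻¹ g)`): **`coindConj_funRepIsoCoindSub`** `D_t ∘ iso = iso ∘ R_{tS}` — so that
`CoinducedConjugation.map_coindConj_comp_shapiroMap` (`Hⁿ(D_t) ≫ Ψ = Ψ ≫ Hⁿ(c_t, ρ(t))`) becomes the
Shapiro–conjugation dictionary for the right action of `G/S` on `Hⁿ(G, Maps(G/S, A)) ≅ Hⁿ(S, A)`.
Lane «TATE-EPC-TC» of cell `bsd-eis`, piece (θ-i)-alg (routed by -w5 g7).

## References
* [Brown1982CohomologyGroups] K. S. Brown, *Cohomology of Groups*, III §5 (induced and co-induced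
  modules, (5.8)–(5.9)), III §6 (Shapiro's lemma (6.2)), III §8 ((8.3), conjugation).
* [NeukirchSchmidtWingberg2008] J. Neukirch, A. Schmidt, K. Wingberg, *Cohomology of Number Fields*,
  I §6 (induced modules `Ind_G^U`, `Maps(G/U, A)`, compatibility with conjugation).
* [SerreLocalFields1979] J.-P. Serre, *Local Fields*, VII §5.
-/

open CategoryTheory

namespace Literature.Algebra.Homology

namespace QuotientMaps

universe u

variable {k G : Type u} [CommRing k] [Group G] (S : Subgroup G) (A : Rep.{u} k G)

open PermutationDual

/-! ### The two maps -/

/-- `(s·g)⁻¹ S = g⁻¹ S`. [cite: Brown1982CohomologyGroups, III §5] -/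
theorem mk_mul_inv (s : S) (g : G) :
    ((((s : G) * g)⁻¹ : G) : G ⧸ S) = ((g⁻¹ : G) : G ⧸ S) := by
  rw [QuotientGroup.eq, inv_inv, mul_inv_cancel_right]
  exact s.2

/-- **`Maps(G/S, A) → Coind_S^G(A|_S)`**, `φ ↦ (g ↦ g · φ(g⁻¹ S))` (`k`-linear).
[cite: Brown1982CohomologyGroups, III §5 (5.8)–(5.9)] -/
def toCoind : (G ⧸ S → A.V) →ₗ[k] coindSub S A where
  toFun φ := ⟨fun g => A.ρ g (φ ((g⁻¹ : G) : G ⧸ S)), fun s g => by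
    change A.ρ ((s : G) * g) (φ ((((s : G) * g)⁻¹ : G) : G ⧸ S)) = A.ρ (s : G) (A.ρ g (φ ((g⁻¹ : G) : G ⧸ S)))
    rw [mk_mul_inv, map_mul, Module.End.mul_apply]⟩
  map_add' φ ψ := Subtype.ext (funext fun g => by
    change A.ρ g ((φ + ψ) ((g⁻¹ : G) : G ⧸ S)) = A.ρ g (φ ((g⁻¹ : G) : G ⧸ S)) + A.ρ g (ψ ((g⁻¹ : G) : G ⧸ S))
    rw [Pi.add_apply, map_add])
  map_smul' c φ := Subtype.ext (funext fun g => by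
    change A.ρ g ((c • φ) ((g⁻¹ : G) : G ⧸ S)) = c • A.ρ g (φ ((g⁻¹ : G) : G ⧸ S))
    rw [Pi.smul_apply, map_smul])

/-- Unfolding `toCoind`. [cite: Brown1982CohomologyGroups, III §5 (5.8)–(5.9)] -/
@[simp] theorem toCoind_apply_coe (φ : G ⧸ S → A.V) (g : G) :
    (toCoind S A φ).1 g = A.ρ g (φ ((g⁻¹ : G) : G ⧸ S)) := rfl

/-- The value `g · f(g⁻¹)` of `f ∈ Coind_S^G(A|_S)` depends only on the coset `g S`.
[cite: Brown1982CohomologyGroups, III §5 (5.8)–(5.9)] -/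
theorem apply_inv_wd (f : coindSub S A) {a b : G} (hab : a⁻¹ * b ∈ S) :
    A.ρ a (f.1 a⁻¹) = A.ρ b (f.1 b⁻¹) := by
  have h := f.2 ⟨a⁻¹ * b, hab⟩⁻¹ a⁻¹
  change f.1 ((a⁻¹ * b)⁻¹ * a⁻¹) = A.ρ ((a⁻¹ * b)⁻¹ : G) (f.1 a⁻¹) at h
  rw [show (a⁻¹ * b)⁻¹ * a⁻¹ = b⁻¹ by group] at h
  rw [h, ← Module.End.mul_apply, ← map_mul]
  congr 2
  group

/-- **`Coind_S^G(A|_S) → Maps(G/S, A)`**, `f ↦ (g S ↦ g · f(g⁻¹))` (`k`-linear).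
[cite: Brown1982CohomologyGroups, III §5 (5.8)–(5.9)] -/
def ofCoind : coindSub S A →ₗ[k] (G ⧸ S → A.V) where
  toFun f y := Quotient.liftOn' y (fun g => A.ρ g (f.1 g⁻¹)) fun a b hab =>
    apply_inv_wd S A f (QuotientGroup.leftRel_apply.mp hab)
  map_add' f f' := funext fun y => QuotientGroup.induction_on y fun g => by
    change A.ρ g ((f.1 + f'.1) g⁻¹) = A.ρ g (f.1 g⁻¹) + A.ρ g (f'.1 g⁻¹)
    rw [Pi.add_apply, map_add]
  map_smul' c f := funext fun y => QuotientGroup.induction_on y fun g => by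
    change A.ρ g ((c • f.1) g⁻¹) = c • A.ρ g (f.1 g⁻¹)
    rw [Pi.smul_apply, map_smul]

/-- Unfolding `ofCoind` on a coset. [cite: Brown1982CohomologyGroups, III §5 (5.8)–(5.9)] -/
@[simp] theorem ofCoind_apply_mk (f : coindSub S A) (g : G) :
    ofCoind S A f (g : G ⧸ S) = A.ρ g (f.1 g⁻¹) := rfl

/-- `ofCoind ∘ toCoind = id`. [cite: Brown1982CohomologyGroups, III §5 (5.8)–(5.9)] -/
theorem ofCoind_toCoind (φ : G ⧸ S → A.V) : ofCoind S A (toCoind S A φ) = φ :=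
  funext fun y => QuotientGroup.induction_on y fun g => by
    rw [ofCoind_apply_mk, toCoind_apply_coe, inv_inv, ← Module.End.mul_apply, ← map_mul,
      mul_inv_cancel, map_one, Module.End.one_apply]

/-- `toCoind ∘ ofCoind = id`. [cite: Brown1982CohomologyGroups, III §5 (5.8)–(5.9)] -/
theorem toCoind_ofCoind (f : coindSub S A) : toCoind S A (ofCoind S A f) = f :=
  Subtype.ext (funext fun g => by
    rw [toCoind_apply_coe, ofCoind_apply_mk, inv_inv, ← Module.End.mul_apply, ← map_mul,
      mul_inv_cancel, map_one, Module.End.one_apply])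

/-- **`Maps(G/S, A) ≃ₗ Coind_S^G(A|_S)`**. [cite: Brown1982CohomologyGroups, III §5 (5.8)–(5.9)] -/
def mapsEquivCoind : (G ⧸ S → A.V) ≃ₗ[k] coindSub S A :=
  { toCoind S A with
    invFun := ofCoind S A
    left_inv := ofCoind_toCoind S A
    right_inv := toCoind_ofCoind S A }

/-- Unfolding. [cite: Brown1982CohomologyGroups, III §5 (5.8)–(5.9)] -/
@[simp] theorem mapsEquivCoind_apply (φ : G ⧸ S → A.V) : mapsEquivCoind S A φ = toCoind S A φ := rfl

/-- Unfolding. [cite: Brown1982CohomologyGroups, III §5 (5.8)–(5.9)] -/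
@[simp] theorem mapsEquivCoind_symm_apply (f : coindSub S A) :
    (mapsEquivCoind S A).symm f = ofCoind S A f := rfl

/-- `toCoind` is `G`-equivariant: `toCoind (g ⋆ φ) = g · toCoind φ`, i.e.
`f_{g ⋆ φ}(x) = f_φ(x g)`. [cite: Brown1982CohomologyGroups, III §5 (5.8)–(5.9)] -/
theorem toCoind_funRepr (g : G) (φ : G ⧸ S → A.V) :
    toCoind S A (funRepr A (G ⧸ S) g φ) = (coindSub S A).ρ g (toCoind S A φ) :=
  Subtype.ext (funext fun x => by
    change A.ρ x (A.ρ g (φ (g⁻¹ • ((x⁻¹ : G) : G ⧸ S)))) = A.ρ (x * g) (φ (((x * g)⁻¹ : G) : G ⧸ S))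
    rw [MulAction.Quotient.smul_coe, smul_eq_mul, ← mul_inv_rev, map_mul, Module.End.mul_apply])

/-- **`Maps(G/S, A) ≅ Coind_S^G(A|_S)` in `Rep k G`.**
[cite: Brown1982CohomologyGroups, III §5 (5.8)–(5.9)] [cite: NeukirchSchmidtWingberg2008, I §6] -/
def funRepIsoCoindSub : funRep A (G ⧸ S) ≅ coindSub S A :=
  Rep.mkIso (Representation.Equiv.mk (mapsEquivCoind S A) fun g => LinearMap.ext fun φ =>
    toCoind_funRepr S A g φ)

/-- Unfolding the isomorphism: `(iso φ)(g) = g · φ(g⁻¹ S)`.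
[cite: Brown1982CohomologyGroups, III §5 (5.8)–(5.9)] -/
@[simp] theorem funRepIsoCoindSub_hom_apply_coe (φ : G ⧸ S → A.V) (g : G) :
    ((funRepIsoCoindSub S A).hom.hom φ : coindSub S A).1 g = A.ρ g (φ ((g⁻¹ : G) : G ⧸ S)) := rfl

/-- Unfolding the inverse: `(iso⁻¹ f)(g S) = g · f(g⁻¹)`.
[cite: Brown1982CohomologyGroups, III §5 (5.8)–(5.9)] -/
@[simp] theorem funRepIsoCoindSub_inv_apply_mk (f : coindSub S A) (g : G) :
    ((funRepIsoCoindSub S A).inv.hom f : G ⧸ S → A.V) (g : G ⧸ S) = A.ρ g (f.1 g⁻¹) := rfl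

/-! ### Right translations (`S` normal) -/

section Normal

variable [S.Normal]

/-- Left and right multiplication on `G ⧸ S` commute with the `G`-action: `g • (y c) = (g • y) c`.
[cite: NeukirchSchmidtWingberg2008, I §6] -/
theorem smul_mul_quotient (g : G) (y c : G ⧸ S) : g • (y * c) = g • y * c := by
  induction y using QuotientGroup.induction_on with
  | H x =>
    induction c using QuotientGroup.induction_on with
    | H t =>
      rw [MulAction.Quotient.smul_coe, ← QuotientGroup.mk_mul, MulAction.Quotient.smul_coe,
        ← QuotientGroup.mk_mul, smul_eq_mul, smul_eq_mul, mul_assoc]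

/-- The right translation `R_c : φ ↦ (y ↦ φ(y c))` as a `k`-linear map.
[cite: NeukirchSchmidtWingberg2008, I §6] [cite: SerreLocalFields1979, VII §5] -/
def rTransLinear (c : G ⧸ S) : (G ⧸ S → A.V) →ₗ[k] (G ⧸ S → A.V) where
  toFun φ y := φ (y * c)
  map_add' _ _ := rfl
  map_smul' _ _ := rfl

/-- **The right translation `R_c` (`c ∈ G/S`) is a `G`-endomorphism of `Maps(G/S, A)`.**
[cite: NeukirchSchmidtWingberg2008, I §6] [cite: SerreLocalFields1979, VII §5] -/
def rTrans (c : G ⧸ S) : funRep A (G ⧸ S) ⟶ funRep A (G ⧸ S) :=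
  Rep.ofHom (LinearMap.intertwiningMap_of_isIntertwiningMap _ _ (rTransLinear S A c) fun g φ =>
    funext fun y => by
      change A.ρ g (φ (g⁻¹ • (y * c))) = A.ρ g (φ (g⁻¹ • y * c))
      rw [smul_mul_quotient])

/-- Unfolding `rTrans`. [cite: SerreLocalFields1979, VII §5] -/
@[simp] theorem rTrans_hom_apply (c : G ⧸ S) (φ : G ⧸ S → A.V) (y : G ⧸ S) :
    ((rTrans S A c).hom φ : G ⧸ S → A.V) y = φ (y * c) := rfl

/-- `R_1 = id`. [cite: SerreLocalFields1979, VII §5] -/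
theorem rTrans_one_apply (φ : G ⧸ S → A.V) : ((rTrans S A 1).hom φ : G ⧸ S → A.V) = φ :=
  funext fun y => by rw [rTrans_hom_apply, mul_one]

/-- `R_{cd} = R_c ∘ R_d` (a LEFT action of `G/S` on functions).
[cite: SerreLocalFields1979, VII §5] -/
theorem rTrans_mul_apply (c d : G ⧸ S) (φ : G ⧸ S → A.V) :
    ((rTrans S A (c * d)).hom φ : G ⧸ S → A.V) = (rTrans S A c).hom ((rTrans S A d).hom φ) :=
  funext fun y => by
    change φ (y * (c * d)) = φ (y * c * d)
    rw [mul_assoc]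

/-- `R_{cd} = R_d ≫ R_c` as morphisms. [cite: SerreLocalFields1979, VII §5] -/
theorem rTrans_mul (c d : G ⧸ S) : rTrans S A (c * d) = rTrans S A d ≫ rTrans S A c :=
  Rep.hom_ext (Representation.IntertwiningMap.ext (LinearMap.ext fun φ => rTrans_mul_apply S A c d φ))

/-- **The isomorphism carries `R_{tS}` to the conjugation operator `D_t`**:
`D_t (iso φ) = iso (R_{tS} φ)`, where `(D_t f)(g) = t · f(t⁻¹ g)`
(`CoinducedConjugation.coindConj`). [cite: Brown1982CohomologyGroups, III §8 (8.3)]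
[cite: NeukirchSchmidtWingberg2008, I §6] -/
theorem coindConj_funRepIsoCoindSub (t : G) (ht : ∀ s ∈ S, t⁻¹ * s * t ∈ S) (φ : G ⧸ S → A.V) :
    (coindConj S A t ht).hom ((funRepIsoCoindSub S A).hom.hom φ) =
      (funRepIsoCoindSub S A).hom.hom ((rTrans S A (t : G ⧸ S)).hom φ) :=
  Subtype.ext (funext fun g => by
    rw [coindConj_hom_apply_coe, funRepIsoCoindSub_hom_apply_coe, funRepIsoCoindSub_hom_apply_coe,
      rTrans_hom_apply, ← Module.End.mul_apply, ← map_mul, mul_inv_cancel_left, mul_inv_rev, inv_inv,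
      QuotientGroup.mk_mul])

end Normal

/-! ### The Shapiro map of the right-action model and its conjugation dictionary -/

open groupCohomology

/-- **The Shapiro map of `Maps(G/S, A)`**: `Hⁿ(G, Maps(G/S, A)) ⟶ Hⁿ(G, Coind_S^G A) ⟶ Hⁿ(S, A)`
(`Hⁿ` of `funRepIsoCoindSub`, then `Ψ = Hⁿ(S ↪ G, ev₁)` of `CoinducedConjugation`).
[cite: Brown1982CohomologyGroups, III §6 (6.2)] -/
noncomputable def shapiroFun (n : ℕ) :
    groupCohomology (funRep A (G ⧸ S)) n ⟶ groupCohomology (resSub S A) n :=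
  map (MonoidHom.id G) (funRepIsoCoindSub S A).hom n ≫ map S.subtype (coindEv S A) n

/-- `R_{tS} ≫ iso = iso ≫ D_t` as morphisms `Maps(G/S, A) ⟶ Coind_S^G(A|_S)`.
[cite: Brown1982CohomologyGroups, III §8 (8.3)] [cite: NeukirchSchmidtWingberg2008, I §6] -/
theorem rTrans_comp_funRepIsoCoindSub_hom [S.Normal] (t : G) (ht : ∀ s ∈ S, t⁻¹ * s * t ∈ S) :
    rTrans S A (t : G ⧸ S) ≫ (funRepIsoCoindSub S A).hom =
      (funRepIsoCoindSub S A).hom ≫ coindConj S A t ht :=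
  Rep.hom_ext (Representation.IntertwiningMap.ext (LinearMap.ext fun φ => by
    change (funRepIsoCoindSub S A).hom.hom ((rTrans S A (t : G ⧸ S)).hom φ) =
      (coindConj S A t ht).hom ((funRepIsoCoindSub S A).hom.hom φ)
    exact (coindConj_funRepIsoCoindSub S A t ht φ).symm))

/-- **The Shapiro–conjugation dictionary in the right-action model**: for `S ⊴ G` and `t ∈ G`,
`Hⁿ(R_{tS}) ≫ Sh = Sh ≫ Hⁿ(c_t, ρ(t))`, where `Sh = shapiroFun` and
`Hⁿ(c_t, ρ(t)) : Hⁿ(S, A) → Hⁿ(S, A)` is the conjugation action along `c_t(s) = t⁻¹ s t`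
(`CoinducedConjugation.subgroupConj` / `resConj`; for normal `S` the hypothesis `ht` is
`Literature.Algebra.Homology.conj_mem_of_normal` of `SubgroupCohomologyConjugation`).
[cite: Brown1982CohomologyGroups, III §8 (8.3)]
[cite: NeukirchSchmidtWingberg2008, I §6] -/
theorem map_rTrans_comp_shapiroFun [S.Normal] (t : G) (ht : ∀ s ∈ S, t⁻¹ * s * t ∈ S) (n : ℕ) :
    map (MonoidHom.id G) (rTrans S A (t : G ⧸ S)) n ≫ shapiroFun S A n =
      shapiroFun S A n ≫ map (subgroupConj S t ht) (resConj S A t ht) n := by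
  rw [shapiroFun, ← Category.assoc, ← map_id_comp, rTrans_comp_funRepIsoCoindSub_hom S A t ht,
    map_id_comp, Category.assoc, map_coindConj_comp_shapiroMap, Category.assoc]

/-- Element form of `map_rTrans_comp_shapiroFun`. [cite: Brown1982CohomologyGroups, III §8 (8.3)] -/
theorem shapiroFun_map_rTrans_apply [S.Normal] (t : G) (ht : ∀ s ∈ S, t⁻¹ * s * t ∈ S) (n : ℕ)
    (x : groupCohomology (funRep A (G ⧸ S)) n) :
    (shapiroFun S A n).hom ((map (MonoidHom.id G) (rTrans S A (t : G ⧸ S)) n).hom x) =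
      (map (subgroupConj S t ht) (resConj S A t ht) n).hom ((shapiroFun S A n).hom x) := by
  have h := congrArg (fun φ => φ.hom x) (map_rTrans_comp_shapiroFun S A t ht n)
  simpa only [ModuleCat.hom_comp, LinearMap.comp_apply] using h

end QuotientMaps

end Literature.Algebra.Homology
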